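import Literature.Computability.Cryptography.SISFunction
import Literature.Computability.Complexity.StackRoutines
import HarnessLib

/-!
# The parameters of Ajtai's SIS function are polynomial-time computable (discharge of `sisParams_isPolyTimeParams`)

Sibling proof file (D-0014 provefact) of `Literature/Computability/Cryptography/SISFunction.lean`,
which builds Ajtai's function `SIS.sisFunction` with the concrete parameters
`SIS.modulus n = 2^{16 ⌊log₂(2n+4)⌋}`, `SIS.width n = 2 n · 16 ⌊log₂(2n+4)⌋`,
`SIS.normBound n = width n + 1`, and leaves their polynomial-time computability from `1ⁿ`
(`Literature.PQC.sisParams_isPolyTimeParams = IsPolyTimeParams modulus normBound width`, one of the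
TM2-level leaves of `Literature.Computability.Cryptography.owfExist_of_gapSVP_worstCaseHard`, cf. `LatticeOWFProofs.lean`) as a
named fact. This file PROVES it:

* `Literature.PQC.sisParams_isPolyTimeParams_holds : sisParams_isPolyTimeParams`.

Method: explicit structured stack programs (`Com`, `StackPrograms.lean`) over the arithmetic
register bank of `StackArith.lean` plus four program registers (`SIS.PReg`: input, output, two
holding registers), with proved simulations and polynomial step budgets, compiled to Mathlib's
`TM2` model by `Com.mem_FP` and re-indexed along the encodings by `PolyTimeComputable.of_encode`:

* `SIS.countLoop` (`runs_countLoop`): count the input length in binary by repeated `add`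
  (`x := x + 1` per input bit; quadratic budget);
* `SIS.modProg` (`runs_modProg`, `modFn_mem_FP`, `polyTimeComputable_modulus`): `x := n + 2`,
  normalise (`|encodeNat (n+2)| = size (n+2) = ⌊log₂(2n+4)⌋ = SIS.logLen n`, `size_add_two`),
  then emit `1` and sixteen `0`s per bit of `x`: the output is
  `0^{16 logLen n} 1 = encodeNat (2^{bitWidth n}) = encodeNat (modulus n)`
  (`encodeNat_two_pow_eq_replicate`);
* `SIS.coreProg` / `SIS.widthProg` (`runs_coreProg`, `runs_widthProg`, `widthFn_mem_FP`,
  `polyTimeComputable_width`): keep a copy of `n`, compute `L = logLen n` as a register length as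
  above, form `32 n` (five low zeros) and add it `L` times (`SIS.addLoopB`): `32 n L = width n`
  (`bitsToNat_res`), normalised to `encodeNat (width n)` (`norm_eq_encodeNat`);
* `SIS.ratProg` (`runs_ratProg`, `ratFn_mem_FP`, `polyTimeComputable_normBoundRat`): from
  `width n`, add one, normalise, and write `encodeRat (width n + 1) =
  boolPair (boolPair [false] (encodeNat (width n + 1))) [true]` (`encodeRat_natCast`: numerator
  `(+, width n + 1)`, denominator `1`) by pushing the fixed tail, the doubled bits
  (`Com.emitLoop` at level 2) and the fixed head; `normBound n = ((width n + 1 : ℕ) : ℚ)`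
  (`SIS.normBoundRat`, `normBound_eq_normBoundRat`).

All budgets are explicit quadratic polynomials in the input length (`modBudget`, `coreBudget`,
`widthBudget`, `ratBudget`).

Relocations owed (generic material housed here): `iterInc` with its value and length lemmas
belongs next to `Com.iterAdd` in `StackRoutines.lean` (which now provides the generic `Com.pushN`,
`Com.iterAdd` used below; this file's former copies are gone); `encodeRat_natCast` belongs next
to `encodeRat` (`EuclideanLattices/Encoding.lean`); `encodeNat_length_eq_size` and
`encodeNat_two_pow_eq_replicate` are, up to their names, the lemmas `Literature.Computability.Cryptography.length_encodeNat` of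
`Cryptography/ShorClassicalOracle.lean` and `Literature.Computability.AlgebraicComplexity.TavRecode.encodeNat_two_pow` of
`AlgebraicComplexity/RealTauConjectureDefinable.lean`, whose import closures (quantum circuits,
algebraic complexity) are foreign to this file — all four belong in `BoolEncodings.lean`, and the
two copies here are named apart to avoid bare-name clashes until then.

## References

* S. Arora, B. Barak, *Computational Complexity: A Modern Approach*, CUP 2009, §1.3
  (polynomial time on Turing machines; robustness), §0.1 (representations).
* O. Regev, *On lattices, learning with errors, random linear codes, and cryptography*,
  J. ACM 56 (2009), §3 (efficiently computable parameters).
* D. E. Knuth, *The Art of Computer Programming*, Vol. 2, 3rd ed., 1998, §4.3.1 (the addition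
  routine of `StackArith.lean` used here).
-/

noncomputable section

namespace Literature.Computability.Cryptography.SIS

open _root_.Computability Complexity Complexity.Com Complexity.AReg

/-- The four program registers added to the arithmetic bank `AReg`: input, output and two
holding registers. [folklore] -/
inductive PReg where
  | inp | out | a | b
  deriving DecidableEq, Fintype, Repr

/-- The register type of the parameter programs: the arithmetic bank plus `PReg`. [folklore] -/
abbrev PR : Type := AReg ⊕ PReg

namespace PReg

/-- A file of the four program registers given register by register. [folklore] -/
def pfile (i o a b : List Bool) : Regs PReg
  | .inp => i | .out => o | .a => a | .b => b

section
variable (i o a b v : List Bool)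
/-- Reading `inp`. [folklore] -/ @[simp] theorem pfile_inp : pfile i o a b .inp = i := rfl
/-- Reading `out`. [folklore] -/ @[simp] theorem pfile_out : pfile i o a b .out = o := rfl
/-- Reading `a`. [folklore] -/ @[simp] theorem pfile_a : pfile i o a b .a = a := rfl
/-- Reading `b`. [folklore] -/ @[simp] theorem pfile_b : pfile i o a b .b = b := rfl
/-- Writing `inp`. [folklore] -/
@[simp] theorem update_pfile_inp : Function.update (pfile i o a b) .inp v = pfile v o a b := by
  funext r; cases r <;> rfl
/-- Writing `out`. [folklore] -/
@[simp] theorem update_pfile_out : Function.update (pfile i o a b) .out v = pfile i v a b := by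
  funext r; cases r <;> rfl
/-- Writing `a`. [folklore] -/
@[simp] theorem update_pfile_a : Function.update (pfile i o a b) .a v = pfile i o v b := by
  funext r; cases r <;> rfl
/-- Writing `b`. [folklore] -/
@[simp] theorem update_pfile_b : Function.update (pfile i o a b) .b v = pfile i o a v := by
  funext r; cases r <;> rfl
end

end PReg

open PReg

/-- The initial register file of the parameter programs: input in `inp`, everything else
empty. [folklore] -/
theorem init_eq (z : List Bool) :
    Regs.init (Sum.inr PReg.inp : PR) z = Sum.elim (file [] [] [] [] [] [] [] []) (pfile z [] [] []) := by
  funext r; rcases r with r | r <;> cases r <;> rfl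

/-! ### Counting the input length in binary -/

/-- The bank's `add` on the full register type. [folklore] -/
def addP : Com PR := add.map Sum.inl

/-- `countLoop`: pop the input register bit by bit, adding `y` (kept at `1`) to `x` each time:
`x := x + |inp|`. [folklore] -/
def countLoop : Com PR := loop (Sum.inr .inp) addP addP

/-- Iterated increment of a bit string (the functional model of `countLoop`). [folklore] -/
def iterInc : ℕ → List Bool → List Bool
  | 0, xs => xs
  | k + 1, xs => iterInc k (addRes xs [true])

/-- Value of the iterated increment. [folklore] -/
theorem bitsToNat_iterInc : ∀ (k : ℕ) (xs : List Bool),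
    Complexity.bitsToNat (iterInc k xs) = Complexity.bitsToNat xs + k
  | 0, xs => rfl
  | k + 1, xs => by
    rw [iterInc, bitsToNat_iterInc k, bitsToNat_addRes]
    simp; omega

/-- Length of the iterated increment: at most one more bit per step (from a nonempty start
bound). [folklore] -/
theorem length_iterInc_le : ∀ (k : ℕ) (xs : List Bool) (m : ℕ), 1 ≤ m → xs.length ≤ m →
    (iterInc k xs).length ≤ m + k
  | 0, xs, m, _, h => by simpa [iterInc] using h
  | k + 1, xs, m, hm, h => by
    rw [iterInc]
    have h1 : (addRes xs [true]).length ≤ m + 1 := by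
      have := length_addRes_le_max xs [true]
      simp only [List.length_singleton] at this
      omega
    have := length_iterInc_le k (addRes xs [true]) (m + 1) (by omega) h1
    omega

/-- **Simulation of `countLoop`.** With `y = [true]` and clean scratch, the loop empties `inp`
and replaces `x` by `iterInc |inp| x`, within `(13 (m + |inp|) + 40) · |inp| + 1` steps when
`|x| ≤ m`, `1 ≤ m`. [folklore] -/
theorem runs_countLoop (w : List Bool) :
    ∀ (xs z u g : List Bool) (m : ℕ), 1 ≤ m → xs.length ≤ m → ∀ (o a b : List Bool),
      Runs countLoop (Sum.elim (file xs [true] z [] [] u [] g) (pfile w o a b))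
        (Sum.elim (file (iterInc w.length xs) [true] z [] [] u [] g) (pfile [] o a b))
        ((13 * (m + w.length) + 40) * w.length + 1) := by
  induction w with
  | nil =>
    intro xs z u g m hm hxs o a b
    exact (Runs.loop_nil _ _ (by rfl)).of_eq (by rfl) (by simp)
  | cons c w ih =>
    intro xs z u g m hm hxs o a b
    have hbody : Runs addP (Sum.elim (file xs [true] z [] [] u [] g) (pfile w o a b))
        (Sum.elim (file (addRes xs [true]) [true] z [] [] u [] g) (pfile w o a b))
        (13 * (xs.length + 1) + 12) :=
      (runs_add xs [true] z u g).inl _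
    have h1 : (addRes xs [true]).length ≤ m + 1 := by
      have := length_addRes_le_max xs [true]
      simp only [List.length_singleton] at this
      omega
    have hrest := ih (addRes xs [true]) z u g (m + 1) (by omega) h1 o a b
    have hk : (Sum.elim (file xs [true] z [] [] u [] g) (pfile (c :: w) o a b)) (Sum.inr PReg.inp) =
        c :: w := rfl
    have hupd : Function.update (Sum.elim (file xs [true] z [] [] u [] g) (pfile (c :: w) o a b))
        (Sum.inr PReg.inp) w = Sum.elim (file xs [true] z [] [] u [] g) (pfile w o a b) := by
      rw [Sum.update_elim_inr, update_pfile_inp]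
    cases c
    · refine (Runs.loop_false' hk hupd hbody hrest).of_eq rfl ?_
      simp only [List.length_cons]
      nlinarith [hxs]
    · refine (Runs.loop_true' hk hupd hbody hrest).of_eq rfl ?_
      simp only [List.length_cons]
      nlinarith [hxs]

end Literature.Computability.Cryptography.SIS

/-! ### Emission and the modulus program -/

namespace Literature.Computability.Cryptography.SIS

open _root_.Computability Polynomial Complexity Complexity.Com Complexity.AReg PReg

/-- The bank's `normalize` on the full register type. [folklore] -/
def normalizeP : Com PR := normalize.map Sum.inl

/-- **The modulus program.** `x := 2`, `y := 1`; count the input (`x = n + 2`); normalise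
(`x = encodeNat (n+2)`, of length `⌊log₂(2n+4)⌋`); emit `true` and then sixteen `false` bits per
bit of `x` on `out` (`Com.fillLoop`): `out = 0^{16 ⌊log₂(2n+4)⌋} 1 = encodeNat (SIS.modulus n)`.
[folklore] -/
def modProg : Com PR :=
  push (Sum.inl .y) true ;; push (Sum.inl .x) true ;; push (Sum.inl .x) false ;; countLoop ;;
    normalizeP ;; push (Sum.inr .out) true ;; fillLoop .x PReg.out false 16

/-- The function computed by `modProg` (on all inputs; it depends on the input length only).
[folklore] -/
def modFn (w : List Bool) : List Bool :=
  List.replicate (16 * (w.length + 2).size) false ++ [true]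

/-- A budget for `modProg`. [folklore] -/
def modBudget : Polynomial ℕ := 50 * (X + 3) ^ 2

/-- The counted value: `iterInc n [false, true]` is `n + 2` in binary. [folklore] -/
theorem norm_iterInc_two (n : ℕ) : norm (iterInc n [false, true]) = encodeNat (n + 2) := by
  rw [norm_eq_encodeNat, bitsToNat_iterInc]
  simp; ring_nf

/-- The length of a binary numeral is the binary size. [folklore] -/
theorem encodeNat_length_eq_size (m : ℕ) : (encodeNat m).length = m.size := by
  rw [← norm_encodeNat, length_norm, bitsToNat_encodeNat]

/-- **Simulation of `modProg`.** [folklore] -/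
theorem runs_modProg (w : List Bool) :
    Runs modProg (Regs.init (Sum.inr PReg.inp) w)
      (Sum.elim (file [] [true] [] [] [] [] [] []) (pfile [] (modFn w) [] []))
      (modBudget.eval w.length) := by
  rw [init_eq]
  set n := w.length with hn
  have h1 : Runs (push (Sum.inl AReg.y : PR) true)
      (Sum.elim (file [] [] [] [] [] [] [] []) (pfile w [] [] []))
      (Sum.elim (file [] [true] [] [] [] [] [] []) (pfile w [] [] [])) 1 :=
    Runs.push' (by rw [Sum.update_elim_inl]; simp)
  have h2 : Runs (push (Sum.inl AReg.x : PR) true)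
      (Sum.elim (file [] [true] [] [] [] [] [] []) (pfile w [] [] []))
      (Sum.elim (file [true] [true] [] [] [] [] [] []) (pfile w [] [] [])) 1 :=
    Runs.push' (by rw [Sum.update_elim_inl]; simp)
  have h3 : Runs (push (Sum.inl AReg.x : PR) false)
      (Sum.elim (file [true] [true] [] [] [] [] [] []) (pfile w [] [] []))
      (Sum.elim (file [false, true] [true] [] [] [] [] [] []) (pfile w [] [] [])) 1 :=
    Runs.push' (by rw [Sum.update_elim_inl]; simp)
  have h4 := runs_countLoop w [false, true] [] [] [] 2 (by norm_num) (by simp) [] [] []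
  set v := iterInc w.length [false, true] with hv
  have hvlen : v.length ≤ 2 + n := length_iterInc_le _ _ 2 (by norm_num) (by simp)
  have h5 : Runs normalizeP (Sum.elim (file v [true] [] [] [] [] [] []) (pfile [] [] [] []))
      (Sum.elim (file (norm v) [true] [] [] [] [] [] []) (pfile [] [] [] [])) (9 * v.length + 5) :=
    (runs_normalize v [true] [] [] [] []).inl _
  have hnorm : norm v = encodeNat (n + 2) := norm_iterInc_two _
  have h6 : Runs (push (Sum.inr PReg.out : PR) true)
      (Sum.elim (file (norm v) [true] [] [] [] [] [] []) (pfile [] [] [] []))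
      (Sum.elim (file (norm v) [true] [] [] [] [] [] []) (pfile [] [true] [] [])) 1 :=
    Runs.push' (by rw [Sum.update_elim_inr]; simp)
  have h7 : Runs (fillLoop .x PReg.out false 16 : Com PR)
      (Sum.elim (file (norm v) [true] [] [] [] [] [] []) (pfile [] [true] [] []))
      (Sum.elim (file [] [true] [] [] [] [] [] []) (pfile [] (List.replicate (16 * (norm v).length) false ++ [true]) [] []))
      ((16 + 2) * (norm v).length + 1) :=
    (runs_fillLoop .x PReg.out false 16 (norm v) _ _ rfl).of_eq (by rw [update_file_x, update_pfile_out, pfile_out]) le_rfl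
  have hlen : (norm v).length = (n + 2).size := by rw [hnorm, encodeNat_length_eq_size]
  have hsize : (n + 2).size ≤ n + 2 := Nat.size_le.2 (Nat.lt_two_pow_self)
  refine (h1.seq (h2.seq (h3.seq (h4.seq (h5.seq (h6.seq h7)))))).of_eq ?_ ?_
  · rw [hlen]; rfl
  · rw [hlen]
    simp only [modBudget, eval_mul, eval_pow, eval_add, eval_X, eval_ofNat]
    nlinarith [hvlen, hsize]

/-- **`modFn ∈ FP`.** [folklore] -/
theorem modFn_mem_FP : modFn ∈ FP :=
  Com.mem_FP modProg (Sum.inr PReg.inp) (Sum.inr PReg.out) modBudget modFn fun w =>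
    ⟨_, Or.inl (runs_modProg w), rfl⟩

/-- `encodeNat (2^k) = 0^k 1`. [folklore] -/
theorem encodeNat_two_pow_eq_replicate (k : ℕ) : encodeNat (2 ^ k) = List.replicate k false ++ [true] := by
  refine eq_of_bitsToNat_eq_of_canonical _ _ (encodeNat_canonical _) (Or.inr ⟨_, rfl⟩) ?_
  rw [bitsToNat_encodeNat, bitsToNat_append]
  simp

/-- The binary size of `n + 2` is `⌊log₂(2n+4)⌋ = SIS.logLen n`. [folklore] -/
theorem size_add_two (n : ℕ) : (n + 2).size = logLen n := by
  have h1 : 2 ^ Nat.log 2 (n + 2) ≤ n + 2 := Nat.pow_log_le_self 2 (by omega)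
  have h2 : n + 2 < 2 ^ (Nat.log 2 (n + 2) + 1) := Nat.lt_pow_succ_log_self one_lt_two _
  have hs : (n + 2).size = Nat.log 2 (n + 2) + 1 :=
    le_antisymm (Nat.size_le.2 h2) (Nat.lt_size.2 h1)
  have hl : Nat.log 2 (2 * n + 4) = Nat.log 2 (n + 2) + 1 :=
    Nat.log_eq_of_pow_le_of_lt_pow (by rw [pow_succ]; omega) (by rw [pow_succ]; omega)
  rw [hs, logLen, hl]

/-- **The modulus is polynomial-time computable from `1ⁿ`** (first conjunct of
`sisParams_isPolyTimeParams`). [folklore] -/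
theorem polyTimeComputable_modulus : PolyTimeComputable unaryEncodeNat encodeNat modulus :=
  modFn_mem_FP.of_encode unaryEncodeNat (fun _ => rfl) fun n => by
    show modFn (unaryEncodeNat n) = encodeNat (modulus n)
    rw [modFn, show (unaryEncodeNat n).length = n from unary_decode_encode_nat n, size_add_two,
      modulus, bitWidth, encodeNat_two_pow_eq_replicate]

end Literature.Computability.Cryptography.SIS

/-! ### The width program -/

namespace Literature.Computability.Cryptography.SIS

open _root_.Computability Polynomial Complexity Complexity.Com Complexity.AReg PReg

/-- `addLoopB`: pop register `b` bit by bit, adding `y` to `x` each time: `x := x + |b| · y`.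
[folklore] -/
def addLoopB : Com PR := loop (Sum.inr .b) addP addP

/-- **Simulation of `addLoopB`.** [folklore] -/
theorem runs_addLoopB (v : List Bool) :
    ∀ (xs ys z u g : List Bool) (m : ℕ), xs.length ≤ m → ys.length ≤ m → ∀ (i o a : List Bool),
      Runs addLoopB (Sum.elim (file xs ys z [] [] u [] g) (pfile i o a v))
        (Sum.elim (file (iterAdd ys v.length xs) ys z [] [] u [] g) (pfile i o a []))
        ((26 * (m + v.length) + 14) * v.length + 1) := by
  induction v with
  | nil =>
    intro xs ys z u g m hx hy i o a
    exact (Runs.loop_nil _ _ (by rfl)).of_eq (by rfl) (by simp)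
  | cons c v ih =>
    intro xs ys z u g m hx hy i o a
    have hbody : Runs addP (Sum.elim (file xs ys z [] [] u [] g) (pfile i o a v))
        (Sum.elim (file (addRes xs ys) ys z [] [] u [] g) (pfile i o a v))
        (13 * (xs.length + ys.length) + 12) :=
      (runs_add xs ys z u g).inl _
    have h1 : (addRes xs ys).length ≤ m + 1 := by
      have := length_addRes_le_max xs ys
      have : max xs.length ys.length ≤ m := max_le hx hy
      omega
    have hrest := ih (addRes xs ys) ys z u g (m + 1) h1 (by omega) i o a
    have hk : (Sum.elim (file xs ys z [] [] u [] g) (pfile i o a (c :: v))) (Sum.inr PReg.b) =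
        c :: v := rfl
    have hupd : Function.update (Sum.elim (file xs ys z [] [] u [] g) (pfile i o a (c :: v)))
        (Sum.inr PReg.b) v = Sum.elim (file xs ys z [] [] u [] g) (pfile i o a v) := by
      rw [Sum.update_elim_inr, update_pfile_b]
    cases c
    · refine (Runs.loop_false' hk hupd hbody hrest).of_eq rfl ?_
      simp only [List.length_cons]
      nlinarith [hx, hy]
    · refine (Runs.loop_true' hk hupd hbody hrest).of_eq rfl ?_
      simp only [List.length_cons]
      nlinarith [hx, hy]

/-- **The common core of the width and norm-bound programs.** `y := 1`; count the input into
`x` (`x = n`); keep a copy of `x` in `a`; `x := x + 2`, normalise (`|x| = ⌊log₂(2n+4)⌋ = L`) and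
park `x` in `b`; `y := 32 n` (the copy with five low zeros); then add `y` to `x = 0` once per bit
of `b`: `x = 32 n L = SIS.width n` (not yet normalised). [folklore] -/
def coreProg : Com PR :=
  push (Sum.inl .y) true ;; countLoop ;;
    copy (Sum.inl .x) (Sum.inr .a) (Sum.inl .s) (Sum.inl .t) ;;
    addP ;; addP ;; normalizeP ;;
    move (Sum.inl .x) (Sum.inr .b) (Sum.inl .s) ;;
    clear (Sum.inl .y) ;; move (Sum.inr .a) (Sum.inl .y) (Sum.inl .s) ;;
    pushN (Sum.inl .y) false 5 ;;
    addLoopB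

/-- The count register after `coreProg`'s counting phase: `n` in binary (not normalised).
[folklore] -/
def cnt (n : ℕ) : List Bool := iterInc n []

/-- The summand register of `coreProg`: `32 n`. [folklore] -/
def smd (n : ℕ) : List Bool := List.replicate 5 false ++ cnt n

/-- The result register of `coreProg`: `32 n L` (not normalised). [folklore] -/
def res (n : ℕ) : List Bool := iterAdd (smd n) (n + 2).size []

/-- Value of the count register. [folklore] -/
theorem bitsToNat_cnt (n : ℕ) : Complexity.bitsToNat (cnt n) = n := by
  rw [cnt, bitsToNat_iterInc]; simp

/-- Length of the count register. [folklore] -/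
theorem length_cnt_le (n : ℕ) : (cnt n).length ≤ 1 + n :=
  length_iterInc_le n [] 1 le_rfl (by simp)

/-- Value of the summand register. [folklore] -/
theorem bitsToNat_smd (n : ℕ) : Complexity.bitsToNat (smd n) = 32 * n := by
  rw [smd, bitsToNat_append, bitsToNat_cnt]; simp

/-- Value of the result register: `32 n ⌊log₂(2n+4)⌋ = SIS.width n`. [folklore] -/
theorem bitsToNat_res (n : ℕ) : Complexity.bitsToNat (res n) = width n := by
  rw [res, bitsToNat_iterAdd, bitsToNat_smd, size_add_two, width, bitWidth]
  simp; ring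

/-- A budget for `coreProg`. [folklore] -/
def coreBudget : Polynomial ℕ := 200 * (X + 8) ^ 2

/-- **Simulation of `coreProg`.** [folklore] -/
theorem runs_coreProg (w : List Bool) :
    Runs coreProg (Regs.init (Sum.inr PReg.inp) w)
      (Sum.elim (file (res w.length) (smd w.length) [] [] [] [] [] []) (pfile [] [] [] []))
      (coreBudget.eval w.length) := by
  rw [init_eq]
  set n := w.length with hn
  have h1 : Runs (push (Sum.inl AReg.y : PR) true)
      (Sum.elim (file [] [] [] [] [] [] [] []) (pfile w [] [] []))
      (Sum.elim (file [] [true] [] [] [] [] [] []) (pfile w [] [] [])) 1 :=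
    Runs.push' (by rw [Sum.update_elim_inl]; simp)
  have h2 := runs_countLoop w [] [] [] [] 1 le_rfl (by simp) [] [] []
  rw [← hn] at h2
  change Runs countLoop _ (Sum.elim (file (cnt n) [true] [] [] [] [] [] []) (pfile [] [] [] [])) _ at h2
  have hcnt : (cnt n).length ≤ 1 + n := length_cnt_le n
  -- copy x to a
  have h3 : Runs (copy (Sum.inl AReg.x : PR) (Sum.inr PReg.a) (Sum.inl AReg.s) (Sum.inl AReg.t))
      (Sum.elim (file (cnt n) [true] [] [] [] [] [] []) (pfile [] [] [] []))
      (Sum.elim (file (cnt n) [true] [] [] [] [] [] []) (pfile [] [] (cnt n) []))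
      (10 * (cnt n).length + 3) :=
    (runs_copy (by simp) (by simp) (by simp) (by simp) (by simp) (by simp) _ rfl rfl).of_eq
      (by rw [Sum.update_elim_inr]; simp) (by simp)
  -- x := x + 2
  have h4 : Runs addP (Sum.elim (file (cnt n) [true] [] [] [] [] [] []) (pfile [] [] (cnt n) []))
      (Sum.elim (file (addRes (cnt n) [true]) [true] [] [] [] [] [] []) (pfile [] [] (cnt n) []))
      (13 * ((cnt n).length + 1) + 12) :=
    (runs_add (cnt n) [true] [] [] []).inl _
  set x1 := addRes (cnt n) [true] with hx1
  have hx1len : x1.length ≤ 2 + n := by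
    have := length_addRes_le_max (cnt n) [true]
    rw [← hx1] at this
    simp only [List.length_singleton] at this
    omega
  have h5 : Runs addP (Sum.elim (file x1 [true] [] [] [] [] [] []) (pfile [] [] (cnt n) []))
      (Sum.elim (file (addRes x1 [true]) [true] [] [] [] [] [] []) (pfile [] [] (cnt n) []))
      (13 * (x1.length + 1) + 12) :=
    (runs_add x1 [true] [] [] []).inl _
  set x2 := addRes x1 [true] with hx2
  have hx2len : x2.length ≤ 3 + n := by
    have := length_addRes_le_max x1 [true]
    rw [← hx2] at this
    simp only [List.length_singleton] at this
    omega
  have hx2val : norm x2 = encodeNat (n + 2) := by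
    rw [norm_eq_encodeNat, hx2, bitsToNat_addRes, hx1, bitsToNat_addRes, bitsToNat_cnt]
    rfl
  -- normalise
  have h6 : Runs normalizeP (Sum.elim (file x2 [true] [] [] [] [] [] []) (pfile [] [] (cnt n) []))
      (Sum.elim (file (norm x2) [true] [] [] [] [] [] []) (pfile [] [] (cnt n) [])) (9 * x2.length + 5) :=
    (runs_normalize x2 [true] [] [] [] []).inl _
  set L := (n + 2).size with hL
  have hLlen : (norm x2).length = L := by rw [hx2val, encodeNat_length_eq_size]
  have hLle : L ≤ n + 2 := Nat.size_le.2 (Nat.lt_two_pow_self)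
  -- park x in b
  have h7 : Runs (move (Sum.inl AReg.x : PR) (Sum.inr PReg.b) (Sum.inl AReg.s))
      (Sum.elim (file (norm x2) [true] [] [] [] [] [] []) (pfile [] [] (cnt n) []))
      (Sum.elim (file [] [true] [] [] [] [] [] []) (pfile [] [] (cnt n) (norm x2)))
      (6 * (norm x2).length + 2) :=
    (runs_move (by simp) (by simp) (by simp) _ rfl).of_eq
      (by rw [Sum.update_elim_inl, Sum.update_elim_inr]; simp) (by simp)
  -- y := 32 n
  have h8 : Runs (clear (Sum.inl AReg.y : PR))
      (Sum.elim (file [] [true] [] [] [] [] [] []) (pfile [] [] (cnt n) (norm x2)))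
      (Sum.elim (file [] [] [] [] [] [] [] []) (pfile [] [] (cnt n) (norm x2))) 3 :=
    (runs_clear _ _).of_eq (by rw [Sum.update_elim_inl]; simp) (by simp)
  have h9 : Runs (move (Sum.inr PReg.a : PR) (Sum.inl AReg.y) (Sum.inl AReg.s))
      (Sum.elim (file [] [] [] [] [] [] [] []) (pfile [] [] (cnt n) (norm x2)))
      (Sum.elim (file [] (cnt n) [] [] [] [] [] []) (pfile [] [] [] (norm x2)))
      (6 * (cnt n).length + 2) :=
    (runs_move (by simp) (by simp) (by simp) _ rfl).of_eq
      (by rw [Sum.update_elim_inr, Sum.update_elim_inl]; simp) (by simp)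
  have h10 : Runs (pushN (Sum.inl AReg.y : PR) false 5)
      (Sum.elim (file [] (cnt n) [] [] [] [] [] []) (pfile [] [] [] (norm x2)))
      (Sum.elim (file [] (smd n) [] [] [] [] [] []) (pfile [] [] [] (norm x2))) 5 :=
    (runs_pushN _ _ 5 _).of_eq (by rw [Sum.update_elim_inl]; simp [smd]) le_rfl
  have hsmd : (smd n).length ≤ 6 + n := by
    simp only [smd, List.length_append, List.length_replicate]; omega
  -- the addition loop
  have h11 := runs_addLoopB (norm x2) [] (smd n) [] [] [] (6 + n) (by simp) hsmd [] [] []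
  rw [hLlen] at h11
  refine (h1.seq (h2.seq (h3.seq (h4.seq (h5.seq (h6.seq (h7.seq (h8.seq (h9.seq
    (h10.seq h11)))))))))).of_eq rfl ?_
  rw [hLlen]
  simp only [coreBudget, eval_mul, eval_pow, eval_add, eval_X, eval_ofNat]
  nlinarith [hcnt, hx1len, hx2len, hLle]

/-- **The width program**: the core, normalisation, and moving the result to `out`. [folklore] -/
def widthProg : Com PR :=
  coreProg ;; normalizeP ;; move (Sum.inl .x) (Sum.inr .out) (Sum.inl .s)

/-- The function computed by `widthProg`. [folklore] -/
def widthFn (w : List Bool) : List Bool := encodeNat (width w.length)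

/-- A budget for `widthProg`. [folklore] -/
def widthBudget : Polynomial ℕ := coreBudget + 15 * (X + 8) ^ 2

/-- Length of the result register. [folklore] -/
theorem length_res_le (n : ℕ) : (res n).length ≤ (6 + n) + (n + 2) := by
  have h := length_iterAdd_le (smd n) (n + 2).size [] (6 + n) (by simp)
    (by simp only [smd, List.length_append, List.length_replicate]; have := length_cnt_le n; omega)
  have hLle : (n + 2).size ≤ n + 2 := Nat.size_le.2 (Nat.lt_two_pow_self)
  exact (h.trans (by omega))

/-- **Simulation of `widthProg`.** [folklore] -/
theorem runs_widthProg (w : List Bool) :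
    Runs widthProg (Regs.init (Sum.inr PReg.inp) w)
      (Sum.elim (file [] (smd w.length) [] [] [] [] [] []) (pfile [] (widthFn w) [] []))
      (widthBudget.eval w.length) := by
  set n := w.length with hn
  have h1 := runs_coreProg w
  rw [← hn] at h1
  have h2 : Runs normalizeP
      (Sum.elim (file (res n) (smd n) [] [] [] [] [] []) (pfile [] [] [] []))
      (Sum.elim (file (norm (res n)) (smd n) [] [] [] [] [] []) (pfile [] [] [] [])) (9 * (res n).length + 5) :=
    (runs_normalize (res n) (smd n) [] [] [] []).inl _
  have hval : norm (res n) = widthFn w := by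
    rw [norm_eq_encodeNat, bitsToNat_res, widthFn]
  have hlen : (norm (res n)).length ≤ (res n).length := length_norm_le _
  have h3 : Runs (move (Sum.inl AReg.x : PR) (Sum.inr PReg.out) (Sum.inl AReg.s))
      (Sum.elim (file (norm (res n)) (smd n) [] [] [] [] [] []) (pfile [] [] [] []))
      (Sum.elim (file [] (smd n) [] [] [] [] [] []) (pfile [] (norm (res n)) [] []))
      (6 * (norm (res n)).length + 2) :=
    (runs_move (by simp) (by simp) (by simp) _ rfl).of_eq
      (by rw [Sum.update_elim_inl, Sum.update_elim_inr]; simp) (by simp)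
  refine (h1.seq (h2.seq h3)).of_eq (by rw [hval]) ?_
  have hres := length_res_le n
  simp only [widthBudget, eval_add, eval_mul, eval_pow, eval_X, eval_ofNat]
  nlinarith [hres, hlen]

/-- **`widthFn ∈ FP`.** [folklore] -/
theorem widthFn_mem_FP : widthFn ∈ FP :=
  Com.mem_FP widthProg (Sum.inr PReg.inp) (Sum.inr PReg.out) widthBudget widthFn fun w =>
    ⟨_, Or.inl (runs_widthProg w), rfl⟩

/-- **The width is polynomial-time computable from `1ⁿ`** (second conjunct of
`sisParams_isPolyTimeParams`). [folklore] -/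
theorem polyTimeComputable_width : PolyTimeComputable unaryEncodeNat encodeNat width :=
  widthFn_mem_FP.of_encode unaryEncodeNat (fun _ => rfl) fun n => by
    show widthFn (unaryEncodeNat n) = encodeNat (width n)
    rw [widthFn, show (unaryEncodeNat n).length = n from unary_decode_encode_nat n]

end Literature.Computability.Cryptography.SIS

/-! ### The norm-bound program and the assembly -/

namespace Literature.Computability.Cryptography.SIS

open _root_.Computability Polynomial Complexity Complexity.Com Literature.Algebra.EuclideanLattices Complexity.AReg PReg

/-- **The norm-bound program.** After the core (`x = 32 n L`): `y := 1`, `x := x + 1`,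
normalise (`x = e := encodeNat (width n + 1)`); then write
`encodeRat (width n + 1) = boolPair (boolPair [false] e) [true] = 0⁶ 1 1 · double(e) · 0 1 1`
on `out` backwards: push `1, 1, 0`, pour `x` into `s` (reversing it), double its bits onto
`out`, and push `1, 1, 0⁶`. [folklore] -/
def ratProg : Com PR :=
  coreProg ;; clear (Sum.inl .y) ;; push (Sum.inl .y) true ;; addP ;; normalizeP ;;
    push (Sum.inr .out) true ;; push (Sum.inr .out) true ;; push (Sum.inr .out) false ;;
    pour (Sum.inl .x) (Sum.inl .s) ;; emitLoop .s PReg.out 2 ;;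
    push (Sum.inr .out) true ;; push (Sum.inr .out) true ;; pushN (Sum.inr .out) false 6

/-- The function computed by `ratProg`: the code of the rational `width n + 1`. [folklore] -/
def ratFn (w : List Bool) : List Bool :=
  boolPair (boolPair [false] (encodeNat (width w.length + 1))) [true]

/-- A budget for `ratProg`. [folklore] -/
def ratBudget : Polynomial ℕ := coreBudget + 40 * (X + 8) ^ 2

/-- **Simulation of `ratProg`.** [folklore] -/
theorem runs_ratProg (w : List Bool) :
    Runs ratProg (Regs.init (Sum.inr PReg.inp) w)
      (Sum.elim (file [] [true] [] [] [] [] [] []) (pfile [] (ratFn w) [] []))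
      (ratBudget.eval w.length) := by
  set n := w.length with hn
  have h1 := runs_coreProg w
  rw [← hn] at h1
  have h2 : Runs (clear (Sum.inl AReg.y : PR))
      (Sum.elim (file (res n) (smd n) [] [] [] [] [] []) (pfile [] [] [] []))
      (Sum.elim (file (res n) [] [] [] [] [] [] []) (pfile [] [] [] [])) (2 * (smd n).length + 1) :=
    (runs_clear _ _).of_eq (by rw [Sum.update_elim_inl]; simp) (by simp)
  have h3 : Runs (push (Sum.inl AReg.y : PR) true)
      (Sum.elim (file (res n) [] [] [] [] [] [] []) (pfile [] [] [] []))
      (Sum.elim (file (res n) [true] [] [] [] [] [] []) (pfile [] [] [] [])) 1 :=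
    Runs.push' (by rw [Sum.update_elim_inl]; simp)
  have h4 : Runs addP (Sum.elim (file (res n) [true] [] [] [] [] [] []) (pfile [] [] [] []))
      (Sum.elim (file (addRes (res n) [true]) [true] [] [] [] [] [] []) (pfile [] [] [] []))
      (13 * ((res n).length + 1) + 12) :=
    (runs_add (res n) [true] [] [] []).inl _
  set x1 := addRes (res n) [true] with hx1
  have hres := length_res_le n
  have hx1len : x1.length ≤ (res n).length + 2 := by
    have := length_addRes_le_max (res n) [true]
    rw [← hx1] at this
    simp only [List.length_singleton] at this
    omega
  have h5 : Runs normalizeP (Sum.elim (file x1 [true] [] [] [] [] [] []) (pfile [] [] [] []))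
      (Sum.elim (file (norm x1) [true] [] [] [] [] [] []) (pfile [] [] [] [])) (9 * x1.length + 5) :=
    (runs_normalize x1 [true] [] [] [] []).inl _
  set e := norm x1 with he
  have heval : e = encodeNat (width n + 1) := by
    rw [he, norm_eq_encodeNat, hx1, bitsToNat_addRes, bitsToNat_res]; rfl
  have helen : e.length ≤ x1.length := length_norm_le _
  have h6a : Runs (push (Sum.inr PReg.out : PR) true)
      (Sum.elim (file e [true] [] [] [] [] [] []) (pfile [] [] [] []))
      (Sum.elim (file e [true] [] [] [] [] [] []) (pfile [] [true] [] [])) 1 :=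
    Runs.push' (by rw [Sum.update_elim_inr]; simp)
  have h6b : Runs (push (Sum.inr PReg.out : PR) true)
      (Sum.elim (file e [true] [] [] [] [] [] []) (pfile [] [true] [] []))
      (Sum.elim (file e [true] [] [] [] [] [] []) (pfile [] [true, true] [] [])) 1 :=
    Runs.push' (by rw [Sum.update_elim_inr]; simp)
  have h6c : Runs (push (Sum.inr PReg.out : PR) false)
      (Sum.elim (file e [true] [] [] [] [] [] []) (pfile [] [true, true] [] []))
      (Sum.elim (file e [true] [] [] [] [] [] []) (pfile [] [false, true, true] [] [])) 1 :=
    Runs.push' (by rw [Sum.update_elim_inr]; simp)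
  have h7 : Runs (pour (Sum.inl AReg.x : PR) (Sum.inl AReg.s))
      (Sum.elim (file e [true] [] [] [] [] [] []) (pfile [] [false, true, true] [] []))
      (Sum.elim (file [] [true] [] e.reverse [] [] [] []) (pfile [] [false, true, true] [] []))
      (3 * e.length + 1) :=
    (runs_pour (by simp) _).of_eq (by rw [Sum.update_elim_inl, Sum.update_elim_inl]; simp) (by simp)
  have h8 : Runs (emitLoop .s PReg.out 2 : Com PR)
      (Sum.elim (file [] [true] [] e.reverse [] [] [] []) (pfile [] [false, true, true] [] []))
      (Sum.elim (file [] [true] [] [] [] [] [] []) (pfile [] (repBits 2 e ++ [false, true, true]) [] []))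
      (4 * e.length + 1) :=
    (runs_emitLoop .s PReg.out 2 e.reverse _ _ rfl).of_eq
      (by rw [update_file_s, update_pfile_out, pfile_out, List.reverse_reverse]) (by simp)
  set d := repBits 2 e ++ [false, true, true] with hd
  have h9a : Runs (push (Sum.inr PReg.out : PR) true)
      (Sum.elim (file [] [true] [] [] [] [] [] []) (pfile [] d [] []))
      (Sum.elim (file [] [true] [] [] [] [] [] []) (pfile [] (true :: d) [] [])) 1 :=
    Runs.push' (by rw [Sum.update_elim_inr]; simp)
  have h9b : Runs (push (Sum.inr PReg.out : PR) true)
      (Sum.elim (file [] [true] [] [] [] [] [] []) (pfile [] (true :: d) [] []))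
      (Sum.elim (file [] [true] [] [] [] [] [] []) (pfile [] (true :: true :: d) [] [])) 1 :=
    Runs.push' (by rw [Sum.update_elim_inr]; simp)
  have h9c : Runs (pushN (Sum.inr .out) false 6)
      (Sum.elim (file [] [true] [] [] [] [] [] []) (pfile [] (true :: true :: d) [] []))
      (Sum.elim (file [] [true] [] [] [] [] [] [])
        (pfile [] (List.replicate 6 false ++ true :: true :: d) [] [])) 6 :=
    (runs_pushN _ _ 6 _).of_eq (by rw [Sum.update_elim_inr]; simp) le_rfl
  have hout : List.replicate 6 false ++ true :: true :: d = ratFn w := by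
    rw [ratFn, ← hn, hd, heval]
    simp [boolPair, repBits, List.replicate]
  refine (h1.seq (h2.seq (h3.seq (h4.seq (h5.seq (h6a.seq (h6b.seq (h6c.seq (h7.seq (h8.seq
    (h9a.seq (h9b.seq h9c)))))))))))).of_eq (by rw [hout]) ?_
  have hsmd : (smd n).length ≤ 6 + n := by
    simp only [smd, List.length_append, List.length_replicate]; have := length_cnt_le n; omega
  simp only [ratBudget, eval_add, eval_mul, eval_pow, eval_X, eval_ofNat]
  nlinarith [hres, hx1len, helen, hsmd]

/-- **`ratFn ∈ FP`.** [folklore] -/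
theorem ratFn_mem_FP : ratFn ∈ FP :=
  Com.mem_FP ratProg (Sum.inr PReg.inp) (Sum.inr PReg.out) ratBudget ratFn fun w =>
    ⟨_, Or.inl (runs_ratProg w), rfl⟩

/-- The code of a natural number as a rational: numerator `(+, n)`, denominator `1`.
[Arora–Barak 2009, §0.1] [folklore] -/
theorem encodeRat_natCast (k : ℕ) :
    encodeRat (k : ℚ) = boolPair (boolPair [false] (encodeNat k)) [true] := by
  show boolPair ((encodingBoolBool.pairBool encodingNatBool).encode
      (decide ((k : ℚ).num < 0), (k : ℚ).num.natAbs)) (encodeNat (k : ℚ).den) = _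
  rw [Rat.num_natCast, Rat.den_natCast, Int.natAbs_natCast]
  have h : decide ((k : ℤ) < 0) = false := by simp
  rw [h]
  rfl

/-- The rational sequence realising `SIS.normBound`. [folklore] -/
def normBoundRat (n : ℕ) : ℚ := ((width n + 1 : ℕ) : ℚ)

/-- `normBound n = normBoundRat n`. [folklore] -/
theorem normBound_eq_normBoundRat (n : ℕ) : normBound n = (normBoundRat n : ℝ) := by
  rw [normBoundRat, Rat.cast_natCast, normBound]
  push_cast
  rfl

/-- **The norm bound is polynomial-time computable from `1ⁿ` as a rational** (third conjunct of
`sisParams_isPolyTimeParams`). [folklore] -/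
theorem polyTimeComputable_normBoundRat : PolyTimeComputable unaryEncodeNat encodeRat normBoundRat :=
  ratFn_mem_FP.of_encode unaryEncodeNat (fun _ => rfl) fun n => by
    show ratFn (unaryEncodeNat n) = encodeRat (normBoundRat n)
    rw [ratFn, show (unaryEncodeNat n).length = n from unary_decode_encode_nat n, normBoundRat,
      encodeRat_natCast]

end Literature.Computability.Cryptography.SIS

namespace Literature.Computability.Cryptography

open SIS

/-- **Discharge of the named fact `sisParams_isPolyTimeParams`** (`SISFunction.lean`): the
concrete parameters of Ajtai's SIS function — `modulus n = 2^{16 ⌊log₂(2n+4)⌋}`, `width n =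
32 n ⌊log₂(2n+4)⌋`, `normBound n = width n + 1` — are polynomial-time computable from `1ⁿ` on
Mathlib's `TM2` model, by explicit structured stack programs (`SIS.modProg`, `SIS.widthProg`,
`SIS.ratProg`) with proved simulations and polynomial budgets, compiled by `Com.mem_FP`.
[Arora–Barak 2009, §1.3; Regev 2009, §3 (efficiently computable parameters)] [cite: AroraBarak2009, §1.3] -/
theorem sisParams_isPolyTimeParams_holds : sisParams_isPolyTimeParams :=
  ⟨polyTimeComputable_modulus, polyTimeComputable_width, normBoundRat, normBound_eq_normBoundRat,
    polyTimeComputable_normBoundRat⟩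

end Literature.Computability.Cryptography

end
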